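import Literature.MathematicalPhysics.StatisticalMechanics.HcpFccLatticeSums

/-!
# `OverbindingBudget` / crux `RobustDefectLimitWindows` (stmt-AtomisticToContinuum-31280) — «RunCut» S3a: kernel floor sums for the axial term

Support file (lens-4 g86, hand-in 2 part S3a for the competitor leaf **SW♭** `StackSwapGainFlat(Wide)`): the four kernel-decided box floor sums
behind the enclosures of the registry couplings `J⁽⁴⁾(8/3)` and `J⁽⁷⁾(8/3)` (layer distance `k = 2`, `c² = 2/3`, box `40`, `M = 10¹⁸`) that the
AXIAL (`c/a`) first-order strain coefficient of the TRIPLE move needs (`…OverbindingBudgetAffineRunCutAxial`): `∂_ε J₂ = (8/3)(a⁻⁶J⁽⁴⁾(8/3) −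
a⁻¹²J⁽⁷⁾(8/3))` for `c ↦ c(1+ε)`.  Same evaluator and format as the g84 kernel lane (`…OverbindingBudgetAffineTwinGainKernel`: `boxFloorSum p q δ k R n M`
of `Literature/…/HcpFccLatticeSums`, sound by `boxFloorSum_sound_le/_ge` of `…HcpFccLatticeSumsEval`); values reproduced by exact integer arithmetic
in `g86/numerics/axial_kernel.py`.
[this file: 0 definitions, 4 theorems (`decide +kernel`); standard axioms]
-/

namespace Summit.AtomisticToContinuum.Crystallization.Theorems.OverbindingBudgetAffineRunCutAxialKernel

open Literature.MathematicalPhysics.StatisticalMechanics.StackingSums (boxFloorSum)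

/-- `boxFloorSum 2 3 0 2 40 4 10^18 = 9763999365105` (pattern `0`, layer `2`, exponent `4`, box `40`). [folklore · kernel] -/
theorem boxFloorSum_4_0_2 : boxFloorSum 2 3 0 2 40 4 (10 ^ 18) = 9763999365105 := by
  decide +kernel

/-- `boxFloorSum 2 3 1 2 40 4 10^18 = 9696545325620` (pattern `1`, layer `2`, exponent `4`, box `40`). [folklore · kernel] -/
theorem boxFloorSum_4_1_2 : boxFloorSum 2 3 1 2 40 4 (10 ^ 18) = 9696545325620 := by
  decide +kernel

/-- `boxFloorSum 2 3 0 2 40 7 10^18 = 368029656` (pattern `0`, layer `2`, exponent `7`, box `40`). [folklore · kernel] -/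
theorem boxFloorSum_7_0_2 : boxFloorSum 2 3 0 2 40 7 (10 ^ 18) = 368029656 := by
  decide +kernel

/-- `boxFloorSum 2 3 1 2 40 7 10^18 = 343323276` (pattern `1`, layer `2`, exponent `7`, box `40`). [folklore · kernel] -/
theorem boxFloorSum_7_1_2 : boxFloorSum 2 3 1 2 40 7 (10 ^ 18) = 343323276 := by
  decide +kernel

end Summit.AtomisticToContinuum.Crystallization.Theorems.OverbindingBudgetAffineRunCutAxialKernel
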